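import Literature.NumberTheory.EllipticCurves.Rank1Residual.Typed.KolyvaginCertificate
import Literature.NumberTheory.EllipticCurves.BSDSelmerProofs
import Literature.NumberTheory.EllipticCurves.HeegnerPointsKolyvaginDescentProofs
import Literature.NumberTheory.EllipticCurves.MordellWeilTheoremProofs
import HarnessLib

/-!
# The `p`-descent certificate in its native shape: `#Sel^(p)(E/K) = p` and a point outside `pE(K)` give `Ш(E/K)[p] = 0` (cell `b2b-bsdres`)

HONEST FRAMING (run/shared/lean/b2b/bsd-rank1-residual/, verbatim): the goal of the cell is to
DELETE the COMBINATION-SHAPED residual classes for ALL analytic-rank `≤ 1` elliptic curves over `ℚ`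
— "full BSD formula for every rank `≤ 1` curve in class C" assembled STRICTLY from published
theorems — so that the rank-`≤ 1` remainder becomes exactly the CONSTRUCTION-SHAPED classes, which
are TYPED (missing-input `Prop`s), NOT attempted. This is not "finishing BSD".

Theorems only (no definition, no named fact). Companion of `Typed/KolyvaginCertificate.lean`
(`bsdp_of_shaAn_unit_of_noPTorsion`: at a pair with `p ∤ #Ш_an`, the certificate `Ш(E/ℚ)[p] = 0`
gives `BSD(E,p)`) and of `Typed/X10ThreeDescentCertificate.lean`.

**What this file records.** The cell's exact `3`-descent certificates (X11 ∧ `p = 3`, census v5: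
628 rank-one pairs; `HOME/b2b-bsdres-x11b/v5/`, `desc3/CERTIFICATES.md`) do not output
"`Ш(E)[3] = 0`" directly: an EXACT-mode run outputs (a) `dim_𝔽₃ Sel^(3)(E/ℚ) = 1`, i.e.
`#Sel^(3)(E/ℚ) = 3`, and (b) a rational point `P` (Cremona's generator) whose Kummer image
`F(P) ∈ Sel^(3)` is non-trivial, i.e. `P ∉ 3E(ℚ)`. The passage (a) ∧ (b) ⇒ `Ш(E/ℚ)[3] = 0` was a
paper step ((T5) of `CERTIFICATES.md` §2, rank-one form). Here it is a kernel theorem over any number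
field, from the tree's PROVED fundamental exact sequence
`0 → E(K)/nE(K) → Sel^(n)(E/K) → Ш(E/K)[n] → 0` (`selmer_exact_holds`, `BSDSelmerProofs`;
Silverman *AEC* X.4.2(a)):

* `noPTorsion_of_card_selmerGroup_eq_prime`: for a prime `p`, if `#Sel^(p)(E/K) = p` and some
  `P ∈ E(K)` is not in `pE(K)`, then `Ш(E/K)[p] = 0` (the Kummer image of `E(K)` is a non-trivial
  subgroup of the group `Sel^(p)` of prime order, hence all of it, so `Sel^(p) → Ш[p]`, which is onto,
  is zero).
* `bsdp_of_card_selmerGroup_eq_prime` (class-free) and `X11.bsdp_of_card_selmerThree`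
  (`ClassX11 W 3`): `BSD(E,p)` at an analytic-rank-`≤ 1` pair with `p ∤ #Ш_an` from the two
  certificate lines (a), (b) — the composition with `bsdp_of_shaAn_unit_of_noPTorsion` /
  `X11.bsdp_of_shaAn_unit_of_noPTorsion` (binders GZK = bsd.S17, Wuthrich Prop. 21 + modularity
  for the X11-shaped form, exactly as there). Not a class theorem: (a) and (b) are per-curve computed
  inputs (Schaefer–Stoll `3`-descent in EXACT mode; the algebraic step of that computation is the
  tree's `ThreeDescentFlexAlgebra*.lean`).
* (appended) `noPTorsion_of_card_selmerGroup_eq_pow_rank`: the GENERAL-RANK form with no point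
  datum — `#Sel^(p)(E/K) = p ^ rank_ℤ E(K)` alone forces `Ш(E/K)[p] = 0`, because Mordell–Weil
  (`module_finite_point_holds`, PROVED) gives `p ^ rank ∣ #(E(K)/pE(K))`
  (`pow_finrank_dvd_natCard_quotient_range_zsmul`) and `E(K)/pE(K) ≅ im κ ≤ Sel^(p)`; consumers
  `bsdp_of_card_selmerGroup_eq_pow_analyticRank` (class-free, `r_an ≤ 1`, `p ∤ #Ш_an`,
  `#Sel^(p) = p ^ r_an` via GZK) and `X11.bsdp_three_of_card_selmerThree_pow` (ClassX11 at `3`):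
  one statement for the 628 rank-one pairs (`#Sel₃ = 3`) AND the 112 rank-zero pairs with
  `3 ∤ #Ш_an` (`#Sel₃ = 1`) of the X11 ∧ `p = 3` census.
-/

noncomputable section

open scoped Classical

open WeierstrassCurve Literature.NumberTheory.EllipticCurves

namespace Literature.NumberTheory.EllipticCurves.Rank1Residual.Typed

section General

variable {K : Type*} [Field K] [NumberField K] (W : WeierstrassCurve K)

/-- **`#Sel^(p)(E/K) = p` and a point outside `pE(K)` force `Ш(E/K)[p] = 0`.** For a prime `p`:
by the fundamental exact sequence (`selmer_exact_holds`) the Kummer map `κ : E(K) → H¹(K, E[p])`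
has kernel `pE(K)` and image `Sel^(p) ∩ ker(H¹(K,E[p]) → H¹(K,E))`, and `Sel^(p)` maps onto
`Ш(E/K)[p]`; a point `P ∉ pE(K)` gives `κ(P) ≠ 0`, so the image of `κ` is a non-trivial subgroup of
the group `Sel^(p)` of prime order `p`, hence equal to it; thus `Sel^(p)` dies in `H¹(K, E)` and
`Ш(E/K)[p] = Sel^(p) ↦ 0`. This is the rank-one EXACT `p`-descent certificate in its native shape
(`dim Sel^(p) = 1`, generator not divisible by `p`). [cite: SilvermanAEC2009, Thm X.4.2(a)] -/
theorem noPTorsion_of_card_selmerGroup_eq_prime (p : ℕ) [hp : Fact p.Prime]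
    (hcard : Nat.card (W.selmerGroup (p : ℤ)) = p)
    (hP : ∃ P : W.toAffine.Point,
      P ∉ (zsmulAddGroupHom (α := W.toAffine.Point) (p : ℤ)).range) :
    ∀ x : W.sha, (p : ℤ) • x = 0 → x = 0 := by
  have hp0 : (p : ℤ) ≠ 0 := by exact_mod_cast hp.out.ne_zero
  obtain ⟨κ, hker, hrange, hmap⟩ := selmer_exact_holds W (p : ℤ) hp0
  obtain ⟨P, hP⟩ := hP
  have hκP : κ P ≠ 0 := by
    intro h0
    apply hP
    rw [← hker, AddMonoidHom.mem_ker]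
    exact h0
  have hle : κ.range ≤ W.selmerGroup (p : ℤ) := by rw [hrange]; exact inf_le_left
  haveI : Finite (W.selmerGroup (p : ℤ)) :=
    Nat.finite_of_card_ne_zero (by rw [hcard]; exact hp.out.ne_zero)
  have hdvd : Nat.card κ.range ∣ p := by
    have := AddSubgroup.card_dvd_of_le hle
    rwa [hcard] at this
  have hne : Nat.card κ.range ≠ 1 := by
    intro h1
    rw [AddSubgroup.card_eq_one] at h1
    have hmem : κ P ∈ κ.range := ⟨P, rfl⟩
    rw [h1, AddSubgroup.mem_bot] at hmem
    exact hκP hmem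
  have hcardR : Nat.card κ.range = p :=
    ((Nat.dvd_prime hp.out).mp hdvd).resolve_left hne
  have heq : κ.range = W.selmerGroup (p : ℤ) :=
    AddSubgroup.eq_of_le_of_card_ge hle (by rw [hcard, hcardR])
  have hSelker : W.selmerGroup (p : ℤ) ≤ (W.torsionH1ToH1 (p : ℤ)).ker := by
    rw [← heq, hrange]; exact inf_le_right
  have hbot : W.sha ⊓ AddSubgroup.torsionBy W.galH1 (p : ℤ) = ⊥ := by
    rw [← hmap, AddSubgroup.map_eq_bot_iff]
    exact hSelker
  intro x hx
  have hx' : (x : W.galH1) ∈ AddSubgroup.torsionBy W.galH1 (p : ℤ) := by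
    rw [AddSubgroup.torsionBy.nsmul_iff, ← natCast_zsmul]
    have := congrArg (Subtype.val : W.sha → W.galH1) hx
    simpa only [AddSubgroupClass.coe_zsmul, ZeroMemClass.coe_zero] using this
  have hmem : (x : W.galH1) ∈ W.sha ⊓ AddSubgroup.torsionBy W.galH1 (p : ℤ) :=
    AddSubgroup.mem_inf.mpr ⟨x.2, hx'⟩
  rw [hbot, AddSubgroup.mem_bot] at hmem
  exact Subtype.ext hmem

end General

section OverQ

variable (W : WeierstrassCurve ℚ) [W.IsElliptic] (p : ℕ) [Fact p.Prime]

/-- **`BSD(E,p)` in analytic rank `≤ 1` at a pair with `p ∤ #Ш_an`, from the native `p`-descent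
certificate** `#Sel^(p)(E/ℚ) = p` + a rational point outside `pE(ℚ)` (so `Ш(E/ℚ)[p] = 0`,
`noPTorsion_of_card_selmerGroup_eq_prime`), composed with `bsdp_of_shaAn_unit_of_noPTorsion`
(Gross–Zagier–Kolyvagin `hGZK` = bsd.S17; Miller's last clause). PUBLISHED inputs + a per-curve
certificate; class-free; not a class theorem. [cite: Miller2011LMS, §1 and Def. 1.1] -/
theorem bsdp_of_card_selmerGroup_eq_prime (hGZK : rank_eq_analyticRank_of_analyticRank_le_one)
    (hr : W.analyticRank ≤ 1) {q : ℚ} (hq : shaAn W = (q : ℂ)) (hv : padicValRat p q = 0)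
    (hcard : Nat.card (W.selmerGroup (p : ℤ)) = p)
    (hP : ∃ P : W.toAffine.Point,
      P ∉ (zsmulAddGroupHom (α := W.toAffine.Point) (p : ℤ)).range) : BSDp W p := by
  -- `E(ℚ)`'s group law (`Affine.Point.instAddCommGroup`) takes a `DecidableEq ℚ`; the general lemma
  -- (like `selmer_exact`) carries the classical instance, this binder the computable one: transport
  -- along `Subsingleton.elim`.
  have hinst : (instDecidableEqRat : DecidableEq ℚ) = fun a b => Classical.propDecidable (a = b) :=
    Subsingleton.elim _ _
  rw [hinst] at hP
  exact bsdp_of_shaAn_unit_of_noPTorsion W p hGZK hr hq hv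
    (noPTorsion_of_card_selmerGroup_eq_prime W p hcard hP)

variable [W.IsGloballyMinimal]

/-- **X11 at `p = 3` (census route A in its native shape): `BSD(E,3)` from PUBLISHED theorems plus
the EXACT `3`-descent certificate** — `dim_𝔽₃ Sel^(3)(E/ℚ) = 1` (i.e. `#Sel^(3) = 3`) and a
rational point (Cremona's generator) outside `3E(ℚ)` —, at a pair with `ClassX11 W 3`, analytic rank
`≤ 1` and `3 ∤ #Ш_an`. Binders as in `X11.bsdp_of_shaAn_unit_of_noPTorsion` (Wuthrich 2014 Prop. 21
canonical signature `hW`, GZK `hGZK`, modularity `hmod`). The 628 rank-one X11 ∧ `p = 3` pairs of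
census v5 (`N < 2·10⁴`) are instances (`HOME/b2b-bsdres-x11b/v5/X11P3_V5_table.tsv`: `desc_dimSel3
= 1`, `desc_mw` = generator located in `Sel`). Not a class theorem. [cite: Miller2011LMS, §1 and Def. 1.1] -/
theorem X11.bsdp_three_of_card_selmerThree (hW : Wuthrich2014.sha_dvd_analyticSha)
    (hGZK : rank_eq_analyticRank_of_analyticRank_le_one) (hmod : hasEntireLFunction_rat)
    (hr : W.analyticRank ≤ 1) (hX : ClassX11 W 3) {q : ℚ}
    (hq : shaAn W = (q : ℂ)) (hv : padicValRat 3 q = 0)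
    (hcard : Nat.card (W.selmerGroup (3 : ℤ)) = 3)
    (hP : ∃ P : W.toAffine.Point,
      P ∉ (zsmulAddGroupHom (α := W.toAffine.Point) (3 : ℤ)).range) : BSDp W 3 := by
  have hinst : (instDecidableEqRat : DecidableEq ℚ) = fun a b => Classical.propDecidable (a = b) :=
    Subsingleton.elim _ _
  rw [hinst] at hP
  have h : ∀ x : W.sha, ((3 : ℕ) : ℤ) • x = 0 → x = 0 :=
    noPTorsion_of_card_selmerGroup_eq_prime W 3 (by exact_mod_cast hcard) (by exact_mod_cast hP)
  exact X11.bsdp_of_shaAn_unit_of_noPTorsion W 3 hW hGZK hmod (by norm_num) hr hX hq hv h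

end OverQ

section GeneralRank

variable {K : Type*} [Field K] [NumberField K] (W : WeierstrassCurve K) [W.IsElliptic]

/-- **General-rank native certificate: `#Sel^(p)(E/K) = p ^ rank_ℤ E(K)` forces `Ш(E/K)[p] = 0`**,
with no point datum. By Mordell–Weil (`module_finite_point_holds`) `p ^ rank ∣ #(E(K)/pE(K))`
(`pow_finrank_dvd_natCard_quotient_range_zsmul`); by the PROVED fundamental exact sequence
(`selmer_exact_holds`) `E(K)/pE(K) ≅ im κ ≤ Sel^(p)`, so `#im κ` is a multiple of `p ^ rank` dividing
`#Sel^(p) = p ^ rank`: `im κ = Sel^(p)`, `Sel^(p)` dies in `H¹(K, E)`, and `Ш(E/K)[p]`, its image, is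
zero. (`rank_ℤ E(K)` is `W.mordellWeilRank`; at the cell's pairs it is `r_an` by GZK.)
[cite: SilvermanAEC2009, Thm X.4.2(a)] -/
theorem noPTorsion_of_card_selmerGroup_eq_pow_rank (p : ℕ) [hp : Fact p.Prime]
    (hcard : Nat.card (W.selmerGroup (p : ℤ)) = p ^ W.mordellWeilRank) :
    ∀ x : W.sha, (p : ℤ) • x = 0 → x = 0 := by
  have hp0 : (p : ℤ) ≠ 0 := by exact_mod_cast hp.out.ne_zero
  haveI : NeZero p := ⟨hp.out.ne_zero⟩
  obtain ⟨κ, hker, hrange, hmap⟩ := selmer_exact_holds W (p : ℤ) hp0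
  haveI : Module.Finite ℤ W.toAffine.Point := W.module_finite_point_holds
  -- `p ^ rank ∣ #(E(K)/pE(K)) = #(im κ)`
  have hdvd1 : p ^ W.mordellWeilRank ∣ Nat.card κ.range := by
    have h := pow_finrank_dvd_natCard_quotient_range_zsmul (A := W.toAffine.Point) p
    have hequiv : Nat.card (W.toAffine.Point ⧸
        (zsmulAddGroupHom (α := W.toAffine.Point) (p : ℤ)).range) = Nat.card κ.range := by
      rw [← hker]
      exact Nat.card_congr (QuotientAddGroup.quotientKerEquivRange κ).toEquiv
    rw [hequiv] at h
    exact h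
  have hle : κ.range ≤ W.selmerGroup (p : ℤ) := by rw [hrange]; exact inf_le_left
  haveI : Finite (W.selmerGroup (p : ℤ)) :=
    Nat.finite_of_card_ne_zero (by rw [hcard]; exact pow_ne_zero _ hp.out.ne_zero)
  have hdvd2 : Nat.card κ.range ∣ p ^ W.mordellWeilRank := by
    have := AddSubgroup.card_dvd_of_le hle
    rwa [hcard] at this
  have hcardR : Nat.card κ.range = p ^ W.mordellWeilRank := Nat.dvd_antisymm hdvd2 hdvd1
  have heq : κ.range = W.selmerGroup (p : ℤ) :=
    AddSubgroup.eq_of_le_of_card_ge hle (by rw [hcard, hcardR])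
  have hSelker : W.selmerGroup (p : ℤ) ≤ (W.torsionH1ToH1 (p : ℤ)).ker := by
    rw [← heq, hrange]; exact inf_le_right
  have hbot : W.sha ⊓ AddSubgroup.torsionBy W.galH1 (p : ℤ) = ⊥ := by
    rw [← hmap, AddSubgroup.map_eq_bot_iff]
    exact hSelker
  intro x hx
  have hx' : (x : W.galH1) ∈ AddSubgroup.torsionBy W.galH1 (p : ℤ) := by
    rw [AddSubgroup.torsionBy.nsmul_iff, ← natCast_zsmul]
    have := congrArg (Subtype.val : W.sha → W.galH1) hx
    simpa only [AddSubgroupClass.coe_zsmul, ZeroMemClass.coe_zero] using this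
  have hmem : (x : W.galH1) ∈ W.sha ⊓ AddSubgroup.torsionBy W.galH1 (p : ℤ) :=
    AddSubgroup.mem_inf.mpr ⟨x.2, hx'⟩
  rw [hbot, AddSubgroup.mem_bot] at hmem
  exact Subtype.ext hmem

end GeneralRank

section OverQRank

variable (W : WeierstrassCurve ℚ) [W.IsElliptic] (p : ℕ) [Fact p.Prime]

/-- **`BSD(E,p)` in analytic rank `≤ 1` at a pair with `p ∤ #Ш_an`, from the single certificate line
`#Sel^(p)(E/ℚ) = p ^ r_an`** (so `= 1` in rank `0`, `= p` in rank `1`): Gross–Zagier–Kolyvagin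
(`hGZK`, bsd.S17) turns `r_an` into `rank_ℤ E(ℚ)`, `noPTorsion_of_card_selmerGroup_eq_pow_rank` gives
`Ш(E/ℚ)[p] = 0`, and `bsdp_of_shaAn_unit_of_noPTorsion` (Miller's last clause) concludes. Class-free;
PUBLISHED inputs + a per-curve certificate; not a class theorem. [cite: Miller2011LMS, §1 and Def. 1.1] -/
theorem bsdp_of_card_selmerGroup_eq_pow_analyticRank
    (hGZK : rank_eq_analyticRank_of_analyticRank_le_one) (hr : W.analyticRank ≤ 1) {q : ℚ}
    (hq : shaAn W = (q : ℂ)) (hv : padicValRat p q = 0)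
    (hcard : Nat.card (W.selmerGroup (p : ℤ)) = p ^ W.analyticRank) : BSDp W p := by
  have hrank : W.mordellWeilRank = W.analyticRank := (hGZK W hr).1
  exact bsdp_of_shaAn_unit_of_noPTorsion W p hGZK hr hq hv
    (noPTorsion_of_card_selmerGroup_eq_pow_rank W p (by rw [hrank]; exact hcard))

variable [W.IsGloballyMinimal]

/-- **X11 at `p = 3`, both ranks, ONE certificate line: `#Sel^(3)(E/ℚ) = 3 ^ r_an` ⇒ `BSD(E,3)`** at
a pair with `ClassX11 W 3`, analytic rank `≤ 1` and `3 ∤ #Ш_an` (binders of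
`X11.bsdp_of_shaAn_unit_of_noPTorsion`: Wuthrich Prop. 21 `hW`, GZK `hGZK`, modularity `hmod`). On
census v5 (`N < 2·10⁴`) this is the EXACT `3`-descent output `dim Sel₃ = r_an` of all 628 rank-one
pairs and of the 112 rank-zero pairs with `3 ∤ #Ш_an` (`HOME/b2b-bsdres-x11b/v5/X11P3_V5_table.tsv`).
Not a class theorem. [cite: Miller2011LMS, §1 and Def. 1.1] -/
theorem X11.bsdp_three_of_card_selmerThree_pow (hW : Wuthrich2014.sha_dvd_analyticSha)
    (hGZK : rank_eq_analyticRank_of_analyticRank_le_one) (hmod : hasEntireLFunction_rat)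
    (hr : W.analyticRank ≤ 1) (hX : ClassX11 W 3) {q : ℚ}
    (hq : shaAn W = (q : ℂ)) (hv : padicValRat 3 q = 0)
    (hcard : Nat.card (W.selmerGroup (3 : ℤ)) = 3 ^ W.analyticRank) : BSDp W 3 := by
  have hrank : W.mordellWeilRank = W.analyticRank := (hGZK W hr).1
  have h : ∀ x : W.sha, ((3 : ℕ) : ℤ) • x = 0 → x = 0 :=
    noPTorsion_of_card_selmerGroup_eq_pow_rank W 3 (by rw [hrank]; exact_mod_cast hcard)
  exact X11.bsdp_of_shaAn_unit_of_noPTorsion W 3 hW hGZK hmod (by norm_num) hr hX hq hv h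

end OverQRank

end Literature.NumberTheory.EllipticCurves.Rank1Residual.Typed

end
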